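import Mathlib.Algebra.BigOperators.Fin
import Mathlib.Data.Fintype.Sum
import Mathlib.Data.Fintype.Prod
import Mathlib.Data.Finset.Card
import Mathlib.LinearAlgebra.Matrix.Notation
import Mathlib.Tactic.FinCases
import Mathlib.Tactic.Linarith
import Mathlib.Tactic.Ring
import HarnessLib

/-!
# TWO `(2,3)`-types over one DECIC CM field `K ⊇ k` with `3`-transitive quintic part: `E × B₁ × B₂` — the balanced weights
# of every product of copies are conjugate pairs, Weil SIXFOLD `6`-sets of `B_m × E` and the TENFOLD `10`-set of `B₁ × B̄₂`
# (kernel census, 22-point model, the sixty even permutations of the five conjugate pairs)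

COR-CM (cell `pub-hodgecm2`), seat b30 gen 22 (2026-08-22); count-neutral own lane DECIC-WEIL-23PAIR (gen 21's NEXT SIZED
ITEM «DECIC-23-PAIR via P1»: the degree-`10` sibling of `Census/OcticWeil13Pair`).  Bookkeeping definitions and theorems of a
finite model; no named fact, no geometry, no `sorry`.

SETTING (formalised downstream, `CorCM/DecicWeil23PairFrameTransfer`).  `K ⊇ i(k)` a CM field of degree `10`, `k` imaginary
quadratic, `τ : k → ℂ`; a frame `e : Hom(K, ℂ) ≃ Fin 5 × Bool` (`(e s).2 = [s ∘ i = τ]`, `e s̄ = ((e s).1, ¬(e s).2)`); two CM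
types of `k`-signature `(2,3)` read as `s ∈ Φ_m ⟺ (e s).2 = [(e s).1 ∈ I_m]` with `I_0 = {0, 1}` and `I_1 = {1, 2}` (the types
MEET, `c = true`) or `I_1 = {3, 2}` (DISJOINT, `c = false`) — every ordered pair of distinct `2`-subsets of the five conjugate
pairs is brought to one of these by relabeling the frame; `B_m ⊨ (K; Φ_m)` CM fivefolds, `E ⊨ (k; {τ})`.  Then `k` acts on
`H^{1,0}(B_m × E)` with multiplicities `(2 + 1, 3 + 0) = (3, 3)` (a Weil-type SIXFOLD, Markman's realm) and on
`H^{1,0}(B₁ × B̄₂)` with `(2 + 3, 3 + 2) = (5, 5)` (a Weil-type TENFOLD).  THE GALOIS INPUT: every EVEN permutation of the five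
pairs is induced by an automorphism of `ℂ` fixing `τ` (the totally real quintic `K⁺` has Galois group `A₅` or `S₅`;
equivalently `Aut(ℂ/k)` is `3`-transitive on the five embeddings over `τ`).

MODEL.  `PtD = Bool ⊕ (Fin 2 × (Fin 5 × Bool))`: `inl b` = the embedding of `k` of sign `b`; `inr (m, (a, b))` = the embedding
of `K` of sign `b` in the pair `a`, on a factor of type `m`.  For the even permutation number `r < 60` (`permD r`, the
alternating group `A₅` as a table), `ρ_r⁻¹(type) = phiD c r = {inl true} ⊔ {inr (m, (a, b)) | b = [permD r a ∈ I_m]}`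
(`signTabD c r m a`).  `ModelBalancedD c v T`: the sixty equations `2 · #{x ∈ T | v x ∈ phiD c r} = |T|`.

RESULTS (kernel).
* `balancedD_iff_signed` — the signed form `e + Σ_{m,a} ± d_{m,a} = 0` of the `r`-th equation (`e = N(inl true) − N(inl false)`,
  `d_{m,a} = N(m,a,true) − N(m,a,false)`);
* **`defectD_of_signed` / `exists_defectD_of_modelBalancedD`** — THE DEFECT LAW: `d_{m,a} = d_{m,0}` for all `m, a` AND
  `e = d_{0,0} + d_{1,0}` (solution space of dimension `2` in the `11` unknowns `= ℤ S(B₁) ⊕ ℤ S(B₂)`, `S(B_m) = [E₊] + Σ_a [(m, a, +)]`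
  the Weil weight of the sixfold `B_m × E`; when `d_{0,0}`, `d_{1,0}` have strictly opposite signs the curve defect `e` is too
  small for sixfold parts and the TENFOLD part `{(0,a,+)} ⊔ {(1,a,−)}` (`e`-free) is forced — sequel `Census/DecicWeil23PairParts`).
RECORDED, NOT CLAIMED (same exact census, `work/scratch/a5rows.py`, `multi_types.py`): the rank is `9` under `A₅`, `S₅`, `F₂₀`
and — off the one mirror position — `D₅`, but `5` under `C₅` (for `K` Galois cyclic the conjugate types are twists of ONE
variety: seat b09's `Census/DecicCurveFivefold*`); any THREE distinct `(2,3)`-types are clean (nullity `3`), FOUR are clean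
(nullity `4`) except the `25` configurations `{ab, ac, bc, de}` (type relation `Φ_ab + Φ_ac + Φ_bc + 2Φ_de ≡ const`, nullity
`8`), and FIVE OR MORE distinct types are never clean (rank `≤ 17 = 1 + 4²`, the matrix coefficients of the permutation module
`𝟙 ⊕ V` of `A₅`).
[cite: Pohlmann1968, Thm 1] [cite: GaoUllmo2025, Thm 3.1] [cite: MoonenZarhin1995Duke, Thm. 2.4] [cite: Gordon1999HodgeAVSurvey, 5.13 (ii), 9.2.2]

## References
* [Pohlmann1968] H. Pohlmann, Ann. of Math. 88 (1968), Thm 1.  [GaoUllmo2025] Z. Gao, E. Ullmo, J. Inst. Math. Jussieu 25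
  (2025), Thm 3.1.  [MoonenZarhin1995Duke] B. Moonen, Yu. Zarhin, Duke Math. J. 77 (1995), Thm. 2.4.  [Gordon1999HodgeAVSurvey]
  B. B. Gordon, CRM Monogr. 10 (1999), 5.13 (ii), 9.2.2.  [Milne2020HodgeClassesAV] J. S. Milne, arXiv:2010.08857, 1.2 (a), Thm. 1.

## Provenance
Exact python first (seat folder `work/scratch/census23pair.py`, `a5rows.py`): nullity `2` of the sixty signed equations in the
`11` unknowns for both positions `c`; the nine rows `0,1,2,3,4,5,9,24,48` of `permD` already have rank `9` (used in the proof).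
-/

namespace Summit.HodgeConjecture.CorCM.Census.DecicWeil23Pair

open Finset

/-! ### The model -/

/-- Points: `inl b` = embedding of `k` of sign `b`; `inr (m, (a, b))` = embedding of `K` of sign `b` in the pair `a` on a factor
of type `m`. [cite: GaoUllmo2025, §2.1] -/
abbrev PtD : Type := Bool ⊕ (Fin 2 × (Fin 5 × Bool))

/-- Complex conjugation on the model: the sign flips. [folklore] -/
def cjD : PtD → PtD
  | Sum.inl b => Sum.inl (!b)
  | Sum.inr (m, (a, b)) => Sum.inr (m, (a, !b))

/-- Unfolding of `cjD`, curve slot. [folklore] -/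
theorem cjD_inl (b : Bool) : cjD (Sum.inl b) = Sum.inl (!b) := rfl

/-- Unfolding of `cjD`, fivefold slots. [folklore] -/
theorem cjD_inr (m : Fin 2) (a : Fin 5) (b : Bool) : cjD (Sum.inr (m, (a, b))) = Sum.inr (m, (a, !b)) := rfl

/-- `cjD` is a fixed-point-free involution. [folklore] -/
theorem cjD_facts : (∀ y : PtD, cjD (cjD y) = y) ∧ ∀ y : PtD, cjD y ≠ y := by
  refine ⟨by decide +kernel, by decide +kernel⟩

/-- The sixty EVEN permutations of the five conjugate pairs (the alternating group `A₅`, as a table, in lexicographic order;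
row `0` is the identity). [folklore] -/
def permD : Fin 60 → Fin 5 → Fin 5 :=
  ![
    ![0, 1, 2, 3, 4], ![0, 1, 3, 4, 2], ![0, 1, 4, 2, 3], ![0, 2, 1, 4, 3], ![0, 2, 3, 1, 4], ![0, 2, 4, 3, 1],
    ![0, 3, 1, 2, 4], ![0, 3, 2, 4, 1], ![0, 3, 4, 1, 2], ![0, 4, 1, 3, 2], ![0, 4, 2, 1, 3], ![0, 4, 3, 2, 1],
    ![1, 0, 2, 4, 3], ![1, 0, 3, 2, 4], ![1, 0, 4, 3, 2], ![1, 2, 0, 3, 4], ![1, 2, 3, 4, 0], ![1, 2, 4, 0, 3],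
    ![1, 3, 0, 4, 2], ![1, 3, 2, 0, 4], ![1, 3, 4, 2, 0], ![1, 4, 0, 2, 3], ![1, 4, 2, 3, 0], ![1, 4, 3, 0, 2],
    ![2, 0, 1, 3, 4], ![2, 0, 3, 4, 1], ![2, 0, 4, 1, 3], ![2, 1, 0, 4, 3], ![2, 1, 3, 0, 4], ![2, 1, 4, 3, 0],
    ![2, 3, 0, 1, 4], ![2, 3, 1, 4, 0], ![2, 3, 4, 0, 1], ![2, 4, 0, 3, 1], ![2, 4, 1, 0, 3], ![2, 4, 3, 1, 0],
    ![3, 0, 1, 4, 2], ![3, 0, 2, 1, 4], ![3, 0, 4, 2, 1], ![3, 1, 0, 2, 4], ![3, 1, 2, 4, 0], ![3, 1, 4, 0, 2],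
    ![3, 2, 0, 4, 1], ![3, 2, 1, 0, 4], ![3, 2, 4, 1, 0], ![3, 4, 0, 1, 2], ![3, 4, 1, 2, 0], ![3, 4, 2, 0, 1],
    ![4, 0, 1, 2, 3], ![4, 0, 2, 3, 1], ![4, 0, 3, 1, 2], ![4, 1, 0, 3, 2], ![4, 1, 2, 0, 3], ![4, 1, 3, 2, 0],
    ![4, 2, 0, 1, 3], ![4, 2, 1, 3, 0], ![4, 2, 3, 0, 1], ![4, 3, 0, 2, 1], ![4, 3, 1, 0, 2], ![4, 3, 2, 1, 0]]

/-- `permD` lists bijections, pairwise distinct, containing the identity (row `0`). [folklore] -/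
theorem permD_facts : (∀ r : Fin 60, Function.Injective (permD r)) ∧ (∀ r r' : Fin 60, permD r = permD r' → r = r') ∧
    permD 0 = id := by
  refine ⟨by decide +kernel, by decide +kernel, by decide +kernel⟩

/-- **The positions of the two types**: `inPos c 0 b = [b ∈ {0, 1}]` (the type `Φ₁`), `inPos c 1 b = [b ∈ {1, 2}]` for `c = true`
(the types MEET in the pair `1`) and `[b ∈ {3, 2}]` for `c = false` (DISJOINT types). [folklore] -/
def inPos (c : Bool) (m : Fin 2) (b : Fin 5) : Bool :=
  if m = 0 then decide (b = 0 ∨ b = 1) else decide (b = 2 ∨ b = (if c then 1 else 3))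

/-- `signTabD c r m a = [permD r a ∈ I_m]`: whether the label `(a, true)` of a factor of type `m` lies in `ρ_r⁻¹Φ_m`. [folklore] -/
def signTabD (c : Bool) (r : Fin 60) (m : Fin 2) (a : Fin 5) : Bool := inPos c m (permD r a)

/-- Row `0` is the identity: `signTabD c 0 m a = inPos c m a`. [folklore] -/
theorem signTabD_zero (c : Bool) (m : Fin 2) (a : Fin 5) : signTabD c 0 m a = inPos c m a := by
  rw [signTabD, permD_facts.2.2, id]

/-- Both types have `k`-signature `(2,3)`: exactly two of the five pairs carry the sign `true`. [folklore] -/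
theorem card_inPos (c : Bool) (m : Fin 2) : ((univ : Finset (Fin 5)).filter fun a => inPos c m a = true).card = 2 := by
  revert c m; decide

/-- The two types are distinct (as position sets). [folklore] -/
theorem inPos_zero_ne_one (c : Bool) : inPos c 0 ≠ inPos c 1 := by
  intro h
  have h2 := congrFun h 2
  revert h2; cases c <;> decide

/-- **`ρ_r⁻¹(type)` read in the model** (Boolean form). [cite: GaoUllmo2025, Thm 3.1 (3.2)] -/
def inPhiD (c : Bool) (r : Fin 60) : PtD → Bool
  | Sum.inl b => b
  | Sum.inr (m, (a, b)) => b == signTabD c r m a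

/-- `ρ_r⁻¹(type)` as a finset of the model. [cite: GaoUllmo2025, Thm 3.1 (3.2)] -/
def phiD (c : Bool) (r : Fin 60) : Finset PtD := univ.filter fun y => inPhiD c r y = true

/-- Membership, curve slot. [folklore] -/
theorem inl_mem_phiD (c : Bool) (r : Fin 60) (b : Bool) : Sum.inl b ∈ phiD c r ↔ b = true := by
  simp [phiD, inPhiD]

/-- Membership, fivefold slots. [folklore] -/
theorem inr_mem_phiD (c : Bool) (r : Fin 60) (m : Fin 2) (a : Fin 5) (b : Bool) :
    Sum.inr (m, (a, b)) ∈ phiD c r ↔ b = signTabD c r m a := by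
  simp [phiD, inPhiD]

/-- Each `phiD c r` is a CM type of the model (exactly one of `y`, `cjD y`; eleven points). [folklore] -/
theorem phiD_isCMType : ∀ (c : Bool) (r : Fin 60), (∀ y : PtD, (y ∈ phiD c r ↔ cjD y ∉ phiD c r)) ∧ (phiD c r).card = 11 := by
  unfold phiD inPhiD signTabD inPos
  decide +kernel

/-- `phiD c r` as an explicit finset: `{inl true} ⊔ {inr (m, (a, signTabD c r m a))}`. [folklore] -/
theorem phiD_eq (c : Bool) (r : Fin 60) : phiD c r =
    insert (Sum.inl true) ((univ : Finset (Fin 2 × Fin 5)).image fun q => (Sum.inr (q.1, (q.2, signTabD c r q.1 q.2)) : PtD)) := by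
  revert c r
  unfold phiD inPhiD
  decide +kernel

/-! ### Balanced configurations -/

variable {α : Type*}

/-- **Pohlmann's condition for a configuration** of a product of copies of `E, B₁, B₂` under `A₅`-realisation: the sixty
equations `2 · #{x ∈ T | v x ∈ ρ_r⁻¹(type)} = |T|`. [cite: GaoUllmo2025, Thm 3.1 eq. (3.2)] [cite: Pohlmann1968, Thm 1] -/
def ModelBalancedD (c : Bool) (v : α → PtD) (T : Finset α) : Prop :=
  ∀ r : Fin 60, 2 * (T.filter fun x => v x ∈ phiD c r).card = T.card

variable (c : Bool) (v : α → PtD)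

/-- The empty configuration is balanced. [folklore] -/
theorem modelBalancedD_empty : ModelBalancedD c v (∅ : Finset α) := fun _ => by simp

variable {c v}

/-- **Removing a balanced part keeps the balance.** [folklore] -/
theorem ModelBalancedD.sdiff [DecidableEq α] {T G : Finset α} (hT : ModelBalancedD c v T) (hG : ModelBalancedD c v G)
    (hGT : G ⊆ T) : ModelBalancedD c v (T \ G) := by
  intro r
  have key : ∀ (Q : α → Prop) [DecidablePred Q],
      ((T \ G).filter Q).card = (T.filter Q).card - (G.filter Q).card := by
    intro Q _
    rw [← Finset.card_sdiff_of_subset (Finset.filter_subset_filter Q hGT)]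
    congr 1
    ext x
    simp only [Finset.mem_filter, Finset.mem_sdiff]
    tauto
  have h1 := hT r
  have h2 := hG r
  have h3 := Finset.card_sdiff_of_subset hGT
  have h4 : (G.filter fun x => v x ∈ phiD c r).card ≤ (T.filter fun x => v x ∈ phiD c r).card :=
    Finset.card_le_card (Finset.filter_subset_filter _ hGT)
  rw [key, h3]
  omega

/-! ### Counting fibrewise; the signed form -/

variable (v)

/-- `#{x ∈ T | v x ∈ W} = Σ_{y ∈ W} #{x ∈ T | v x = y}`. [folklore] -/
theorem card_filter_mem_eq_sumD (T : Finset α) (W : Finset PtD) :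
    (T.filter fun x => v x ∈ W).card = ∑ y ∈ W, (T.filter fun x => v x = y).card := by
  rw [Finset.card_eq_sum_card_fiberwise (f := v) (s := T.filter fun x => v x ∈ W) (t := W)
    (fun x hx => (Finset.mem_filter.1 (Finset.mem_coe.1 hx)).2)]
  refine Finset.sum_congr rfl fun y hy => ?_
  congr 1
  ext x
  simp only [Finset.mem_filter]
  constructor
  · rintro ⟨⟨hx, -⟩, hxy⟩; exact ⟨hx, hxy⟩
  · rintro ⟨hx, hxy⟩; exact ⟨⟨hx, hxy ▸ hy⟩, hxy⟩

/-- `|T| = Σ_y #{x ∈ T | v x = y}`. [folklore] -/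
theorem card_eq_sumD (T : Finset α) : T.card = ∑ y : PtD, (T.filter fun x => v x = y).card := by
  rw [← card_filter_mem_eq_sumD v T univ]
  congr 1
  ext x
  simp

/-- A sum over the model, expanded by slots. [folklore] -/
theorem sum_ptD (N : PtD → ℕ) : ∑ y : PtD, N y =
    N (Sum.inl true) + N (Sum.inl false) + ∑ m : Fin 2, ∑ a : Fin 5, (N (Sum.inr (m, (a, true))) + N (Sum.inr (m, (a, false)))) := by
  rw [Fintype.sum_sum_type, Fintype.sum_bool, Fintype.sum_prod_type]
  simp only [Fintype.sum_prod_type, Fintype.sum_bool]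

/-- The sum over `phiD c r`, expanded. [folklore] -/
theorem sum_phiD (c : Bool) (r : Fin 60) (N : PtD → ℕ) :
    ∑ y ∈ phiD c r, N y = N (Sum.inl true) + ∑ m : Fin 2, ∑ a : Fin 5, N (Sum.inr (m, (a, signTabD c r m a))) := by
  rw [phiD_eq c r]
  have hinj : Function.Injective fun q : Fin 2 × Fin 5 => (Sum.inr (q.1, (q.2, signTabD c r q.1 q.2)) : PtD) := by
    rintro ⟨m, a⟩ ⟨m', a'⟩ h
    simp only [Sum.inr.injEq, Prod.mk.injEq] at h
    obtain ⟨rfl, rfl, -⟩ := h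
    rfl
  have h1 : Sum.inl true ∉ (univ : Finset (Fin 2 × Fin 5)).image
      fun q => (Sum.inr (q.1, (q.2, signTabD c r q.1 q.2)) : PtD) := by simp
  rw [Finset.sum_insert h1, Finset.sum_image fun q _ q' _ h => hinj h, Fintype.sum_prod_type]

/-- **The signed form of the `r`-th balance equation**: `2 Σ_{y ∈ phiD c r} N y = Σ_y N y` iff
`(N t − N f) + Σ_{m,a} ± (N(m,a,t) − N(m,a,f)) = 0`, the sign being `+` iff `signTabD c r m a`. [cite: GaoUllmo2025, Thm 3.1] -/
theorem balancedD_iff_signed (c : Bool) (r : Fin 60) (N : PtD → ℕ) :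
    2 * ∑ y ∈ phiD c r, N y = ∑ y : PtD, N y ↔
      ((N (Sum.inl true) : ℤ) - N (Sum.inl false)) + ∑ m : Fin 2, ∑ a : Fin 5,
        (if signTabD c r m a then ((N (Sum.inr (m, (a, true))) : ℤ) - N (Sum.inr (m, (a, false))))
          else -(((N (Sum.inr (m, (a, true))) : ℤ) - N (Sum.inr (m, (a, false)))))) = 0 := by
  rw [sum_phiD, sum_ptD]
  have key : ∀ m a, (2 * (N (Sum.inr (m, (a, signTabD c r m a))) : ℤ)) =
      ((N (Sum.inr (m, (a, true))) : ℤ) + N (Sum.inr (m, (a, false)))) +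
        (if signTabD c r m a then ((N (Sum.inr (m, (a, true))) : ℤ) - N (Sum.inr (m, (a, false))))
          else -(((N (Sum.inr (m, (a, true))) : ℤ) - N (Sum.inr (m, (a, false)))))) := by
    intro m a
    cases signTabD c r m a <;> simp <;> ring
  have hsum : (2 * (∑ m : Fin 2, ∑ a : Fin 5, N (Sum.inr (m, (a, signTabD c r m a)))) : ℤ) =
      (∑ m : Fin 2, ∑ a : Fin 5, (((N (Sum.inr (m, (a, true))) : ℤ) + N (Sum.inr (m, (a, false)))))) +
        ∑ m : Fin 2, ∑ a : Fin 5,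
          (if signTabD c r m a then ((N (Sum.inr (m, (a, true))) : ℤ) - N (Sum.inr (m, (a, false))))
            else -(((N (Sum.inr (m, (a, true))) : ℤ) - N (Sum.inr (m, (a, false)))))) := by
    push_cast
    rw [Finset.mul_sum, ← Finset.sum_add_distrib]
    refine Finset.sum_congr rfl fun m _ => ?_
    rw [Finset.mul_sum, ← Finset.sum_add_distrib]
    refine Finset.sum_congr rfl fun a _ => ?_
    exact key m a
  constructor
  · intro h
    have hz : (2 : ℤ) * ((N (Sum.inl true) : ℤ) + ((∑ m : Fin 2, ∑ a : Fin 5, N (Sum.inr (m, (a, signTabD c r m a))) : ℕ) : ℤ)) =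
        (N (Sum.inl true) : ℤ) + N (Sum.inl false) +
          ((∑ m : Fin 2, ∑ a : Fin 5, (N (Sum.inr (m, (a, true))) + N (Sum.inr (m, (a, false)))) : ℕ) : ℤ) := by
      exact_mod_cast h
    push_cast at hz hsum
    linarith
  · intro h
    have hz : (2 : ℤ) * ((N (Sum.inl true) : ℤ) + ((∑ m : Fin 2, ∑ a : Fin 5, N (Sum.inr (m, (a, signTabD c r m a))) : ℕ) : ℤ)) =
        (N (Sum.inl true) : ℤ) + N (Sum.inl false) +
          ((∑ m : Fin 2, ∑ a : Fin 5, (N (Sum.inr (m, (a, true))) + N (Sum.inr (m, (a, false)))) : ℕ) : ℤ) := by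
      push_cast at hsum ⊢
      linarith
    exact_mod_cast hz

/-! ### The defect law -/

/-- **THE DEFECT LAW, linear-algebra core**: the sixty signed `A₅`-equations force each `d_m` to be constant in `a` AND
`e = d_{0,0} + d_{1,0}` (solution space of dimension `2` in the `11` unknowns; the nine rows `0,1,2,3,4,5,9,24,48` suffice).
[cite: MoonenZarhin1995Duke, Thm. 2.4] [cite: GaoUllmo2025, Thm 3.1] -/
theorem defectD_of_signed (c : Bool) (e : ℤ) (d : Fin 2 → Fin 5 → ℤ)
    (h : ∀ r : Fin 60, e + ∑ m : Fin 2, ∑ a : Fin 5, (if signTabD c r m a then d m a else -d m a) = 0) :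
    (∀ (m : Fin 2) (a : Fin 5), d m a = d m 0) ∧ e = d 0 0 + d 1 0 := by
  have h0 := h 0; have h1 := h 1; have h2 := h 2; have h3 := h 3; have h4 := h 4; have h5 := h 5
  have h9 := h 9; have h24 := h 24; have h48 := h 48
  cases c <;>
    simp [Fin.sum_univ_two, Fin.sum_univ_five, signTabD, inPos, permD] at h0 h1 h2 h3 h4 h5 h9 h24 h48 <;>
    refine ⟨fun m a => ?_, by omega⟩ <;>
    fin_cases m <;> fin_cases a <;> simp <;> omega

variable {v}

/-- **THE DEFECT LAW of a balanced configuration**: for each slot `m` ONE integer `t_m` with `N(m,a,true) − N(m,a,false) = t_m`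
for all five `a`, and on the curve `N(inl true) − N(inl false) = t_0 + t_1`. [cite: GaoUllmo2025, Thm 3.1]
[cite: MoonenZarhin1995Duke, Thm. 2.4] -/
theorem exists_defectD_of_modelBalancedD {T : Finset α} (hT : ModelBalancedD c v T) :
    ∃ t : Fin 2 → ℤ, (∀ (m : Fin 2) (a : Fin 5), ((T.filter fun x => v x = Sum.inr (m, (a, true))).card : ℤ) -
        (T.filter fun x => v x = Sum.inr (m, (a, false))).card = t m) ∧
      ((T.filter fun x => v x = Sum.inl true).card : ℤ) - (T.filter fun x => v x = Sum.inl false).card = t 0 + t 1 := by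
  have hs := fun r => (balancedD_iff_signed c r (fun y => (T.filter fun x => v x = y).card)).1 (by
    have h := hT r
    rw [card_filter_mem_eq_sumD, card_eq_sumD v T] at h
    exact h)
  obtain ⟨hd, he⟩ := defectD_of_signed c _
    (fun m a => (((T.filter fun x => v x = Sum.inr (m, (a, true))).card : ℕ) : ℤ) -
      (T.filter fun x => v x = Sum.inr (m, (a, false))).card) hs
  exact ⟨fun m => ((T.filter fun x => v x = Sum.inr (m, ((0 : Fin 5), true))).card : ℤ) -
      (T.filter fun x => v x = Sum.inr (m, ((0 : Fin 5), false))).card, fun m a => hd m a, he⟩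

end Summit.HodgeConjecture.CorCM.Census.DecicWeil23Pair
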